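import Literature.NumberTheory.Automorphic.Arthur2013.Leaves.TorusDictionary   -- ★ `TorusDict.principalIdele_mem_unitIdeles_of_pow_eq_one`, ★ `exists_units_eq_of_mem_unitIdeles`, the constancy currency
import HarnessLib

/-!
# R90 · S10 — brick B3 of L-C′: THE ARCHIMEDEAN COMPENSATION on `μ(L)` (solvability of the constancy condition with one finite component)
# (`exists_archExponents_compensating`; DEAL #54 (α), census road «§45.13 with one finite component»; PROOF, 0 sorry)

Cell `hodgecm-mathlib`, crux H413 (`stmt-HodgeConjecture-24833`), route of record `HCCMUnconditional`; slab R90-TF, section S10 = §13.8; seat R90-C138-p06 (g0),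
DEAL #54 (L-C′: «a character of the compact local torus `U(1)(L⁺_v)` at a NON-SPLIT `v` is the `v`-component of an AUTOMORPHIC character of `U(1)(𝔸_{L⁺})`
trivial on `U(1)(𝒪_w)` off `v`», needed for the R5 binder `hχθK` of ★ `exists_flathBlockH` ∕ p01's `hθχ`).  Proof lane (`--kind proof --supports
stmt-HodgeConjecture-24833 --as helper`); THEOREMS ONLY; Literature-only imports.

THE MATHEMATICS (folklore; the arithmetic kernel of Weil's extension principle [Weil1956 §1], as in ★ `TorusDict.exists_isAutomorphic_of_constancy`, §45.13 of ★
`Arthur2013/Leaves/TorusDictionary`).  The level-one open subgroup `U = T_∞ · ∏_w T(𝒪_w)` of `T(𝔸_{L⁺})` meets `T(L⁺)` in the FINITE CYCLIC group `μ(L)` (★ §45.11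
`mem_torus_and_mem_unitIdeles_iff_isOfFinOrder`, Kronecker); a character `(ψ_v at v) ⊗ (1 off v) ⊗ (Φ_{2e} at ∞)` of `U` descends to `T(L⁺)\T(𝔸)` iff it kills
`μ(L)`, i.e. iff `ψ_v(ζ) · ∏_w ι_w(ζ)^{-e_w} = 1` on `μ(L)` — §45.13's constancy condition `H` with ONE FINITE COMPONENT inserted.  THIS FILE: that condition is
always SOLVABLE in the archimedean exponents `e` — for EVERY character `χ` of `L^×` (only its values on the roots of unity matter) there is `e : InfinitePlace L → ℤ`,
supported at one place `w₀`, with `χ(k) · ∏_w ι_w(k)^{-e_w} = 1` for every `k ∈ L^×` of finite order: `μ(L) = ⟨ζ⟩` is cyclic of order `m` (a finite subgroup of the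
units of a field), `ι_{w₀}(ζ)` is a PRIMITIVE `m`-th root of unity in `ℂ` (an embedding is injective), so `χ(ζ)` — an `m`-th root of unity — is `ι_{w₀}(ζ)^a` for some
`a`, and `e := a·𝟙_{w₀}` works.  §1 re-proves (the ★ file keeps them `private`) that the finite-order elements of `L^×` are `#μ(L)`-th roots of unity, hence finitely
many.  Why it might fail: it cannot — no hypothesis on `L` beyond «number field» (one infinite place exists).
HONEST LABEL: a brick; pays no socket; the Weil re-run with a `v`-component (census 02:58Z, size L) is NOT here; HC_CM is proved only modulo the 7 printed citations (2
remaining named inputs: hLiu418 = stmt-HodgeConjecture-24832, h413 = stmt-HodgeConjecture-24833) until rung 0 closes; REL ≠ ★ ≠ BUILT.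

## References
* [Weil1956] A. Weil, *On a certain type of characters of the idèle-class group of an algebraic number-field*, Proc. Int. Symp. Tokyo–Nikko (1956), §1.
* [Arthur2011Draft] J. Arthur, *The Endoscopic Classification of Representations* (2011 draft), d-p. 319 Remark 2, d-p. 310.
* [CasselsFrohlichANT1967] J. W. S. Cassels, A. Fröhlich (eds.), *Algebraic Number Theory* (1967), Ch. II §18 (units and `S`-units).
-/

set_option autoImplicit false
-- the mandated namespace repeats the single-problem summit's segment (`HodgeConjecture.HodgeConjecture`)
set_option linter.dupNamespace false

noncomputable section

open NumberField IsDedekindDomain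
open Literature.NumberTheory.GaloisRepresentations
open Literature.NumberTheory.Automorphic.Arthur2013.Leaves.TECR

namespace Summit.HodgeConjecture.HodgeConjecture.R90.S10

variable {K : Type} [Field K] [NumberField K]

/-! ## §1 The finite-order elements of `K^×` are the `#μ(K)`-th roots of unity (re-proof of ★ TorusDictionary's private helpers) -/

/-- **An element of finite order of `K^×` is a `#μ(K)`-th root of unity**: it is an integral unit (★ `exists_units_eq_of_mem_unitIdeles` — a root of unity is a unit at
every finite place, ★ `TorusDict.principalIdele_mem_unitIdeles_of_pow_eq_one`) of finite order, i.e. in Mathlib's `NumberField.Units.torsion K`, whose exponent divides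
`Units.torsionOrder K`. [cite: CasselsFrohlichANT1967, Ch. II §18] -/
theorem pow_torsionOrder_eq_one_of_isOfFinOrder {k : Kˣ} (hk : IsOfFinOrder k) : k ^ Units.torsionOrder K = 1 := by
  obtain ⟨n, hn, hkn⟩ := isOfFinOrder_iff_pow_eq_one.mp hk
  obtain ⟨ε, hε⟩ := exists_units_eq_of_mem_unitIdeles (TorusDict.principalIdele_mem_unitIdeles_of_pow_eq_one hn.ne' hkn)
  have hεn : ε ^ n = 1 := by
    apply Units.ext
    apply IsFractionRing.injective (𝓞 K) K
    rw [Units.val_pow_eq_pow_val, map_pow, hε, ← Units.val_pow_eq_pow_val, hkn, Units.val_one, Units.val_one, map_one]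
  have htors : ε ∈ Units.torsion K := (CommGroup.mem_torsion ε).mpr (isOfFinOrder_iff_pow_eq_one.mpr ⟨n, hn, hεn⟩)
  have hpow : ε ^ Units.torsionOrder K = 1 := by
    have h : ε ∈ rootsOfUnity (Units.torsionOrder K) (𝓞 K) := by
      rw [Units.rootsOfUnity_eq_torsion]; exact htors
    exact (mem_rootsOfUnity _ _).mp h
  apply Units.ext
  rw [Units.val_pow_eq_pow_val, ← hε, ← map_pow, ← Units.val_pow_eq_pow_val, hpow, Units.val_one, Units.val_one, map_one]

/-- The torsion subgroup of `K^×` is FINITE (inside the `#μ(K)`-th roots of unity). [cite: CasselsFrohlichANT1967, Ch. II §18] -/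
theorem finite_torsion_units : Finite ↥(CommGroup.torsion Kˣ) := by
  haveI : Finite ↥(rootsOfUnity (Units.torsionOrder K) K) := inferInstance
  refine Finite.of_injective (fun k : ↥(CommGroup.torsion Kˣ) =>
    (⟨k.1, (mem_rootsOfUnity _ _).mpr (pow_torsionOrder_eq_one_of_isOfFinOrder ((CommGroup.mem_torsion _).1 k.2))⟩ :
      ↥(rootsOfUnity (Units.torsionOrder K) K))) fun a b h => ?_
  exact Subtype.ext (congrArg (fun x : ↥(rootsOfUnity (Units.torsionOrder K) K) => (x : Kˣ)) h)

/-! ## §2 The compensation: every character of `μ(K)` is an integral power of one embedding -/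

/-- **THE ARCHIMEDEAN COMPENSATION.**  For every infinite place `w₀` of `K` and every character `χ : K^× → ℂ^×` there are exponents `e : InfinitePlace K → ℤ`
(supported at `w₀`) with `χ(k) · ∏_w ι_w(k)^{-e_w} = 1` for every `k ∈ K^×` of FINITE ORDER — §45.13's constancy condition `H` with the finite datum `χ|_{μ(K)}`
inserted is solvable: `μ(K) = ⟨ζ⟩` is cyclic of order `m`, `ι_{w₀}(ζ)` is a primitive `m`-th root of unity, `χ(ζ) = ι_{w₀}(ζ)^a`, `e := a·𝟙_{w₀}`.
[cite: Weil1956, §1] [cite: Arthur2011Draft, d-p. 319 Remark 2] -/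
theorem exists_archExponents_compensating (w₀ : InfinitePlace K) (χ : Kˣ →* ℂˣ) :
    ∃ e : InfinitePlace K → ℤ, ∀ k : Kˣ, IsOfFinOrder k →
      ((χ k : ℂˣ) : ℂ) * ∏ w : InfinitePlace K, (w.embedding (k : K)) ^ (-e w) = 1 := by
  classical
  -- `μ(K)` is finite cyclic, generated by `ζ` of order `m`
  haveI : Finite ↥(CommGroup.torsion Kˣ) := finite_torsion_units
  obtain ⟨g, hg⟩ := IsCyclic.exists_generator (α := ↥(CommGroup.torsion Kˣ))
  set ζ : Kˣ := g.1 with hζ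
  set m : ℕ := orderOf ζ with hm
  have hζfin : IsOfFinOrder ζ := (CommGroup.mem_torsion _).1 g.2
  have hm0 : 0 < m := hζfin.orderOf_pos
  -- `ι_{w₀}(ζ)` is a primitive `m`-th root of unity in `ℂ` (an embedding is injective)
  set z : ℂ := w₀.embedding ((ζ : Kˣ) : K) with hz_def
  have hprim : IsPrimitiveRoot z m :=
    (IsPrimitiveRoot.coe_units_iff.mpr (IsPrimitiveRoot.orderOf ζ)).map_of_injective (w₀.embedding : K →+* ℂ).injective
  haveI : NeZero m := ⟨hm0.ne'⟩
  have hz : z ≠ 0 := by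
    rw [hz_def, map_ne_zero]
    exact Units.ne_zero ζ
  -- `χ ζ` is an `m`-th root of unity, hence a power of `z`
  have hχm : ((χ ζ : ℂˣ) : ℂ) ^ m = 1 := by
    rw [← Units.val_pow_eq_pow_val, ← map_pow, hm, pow_orderOf_eq_one, map_one, Units.val_one]
  obtain ⟨a, -, ha⟩ := hprim.eq_pow_of_pow_eq_one hχm
  refine ⟨fun w => if w = w₀ then (a : ℤ) else 0, fun k hk => ?_⟩
  -- `k = ζ ^ j`
  have hkmem : (⟨k, (CommGroup.mem_torsion _).2 hk⟩ : ↥(CommGroup.torsion Kˣ)) ∈ Subgroup.zpowers g := hg _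
  obtain ⟨j, hj⟩ := Subgroup.mem_zpowers_iff.1 hkmem
  have hkj : k = ζ ^ j := by
    have h := congrArg (fun x : ↥(CommGroup.torsion Kˣ) => (x : Kˣ)) hj
    simpa [hζ] using h.symm
  -- the product is the single factor at `w₀`
  beta_reduce
  rw [Finset.prod_eq_single w₀ (fun w _ hw => by rw [if_neg hw, neg_zero, zpow_zero]) (fun h => (h (Finset.mem_univ _)).elim),
    if_pos rfl]
  -- compute: `χ(ζ^j) · ι(ζ^j)^(-a) = z^(a j) · z^(-j a) = 1`
  have hχk : ((χ k : ℂˣ) : ℂ) = z ^ ((a : ℤ) * j) := by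
    rw [hkj, map_zpow, Units.val_zpow_eq_zpow_val, ← ha, ← zpow_natCast, ← zpow_mul]
  have hιk : w₀.embedding ((k : Kˣ) : K) = z ^ j := by
    rw [hkj, Units.val_zpow_eq_zpow_val, map_zpow₀]
  rw [hχk, hιk, ← zpow_mul, ← zpow_add₀ hz]
  have h0 : (a : ℤ) * j + j * -(a : ℤ) = 0 := by ring
  rw [h0, zpow_zero]

end Summit.HodgeConjecture.HodgeConjecture.R90.S10

end
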